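import Summits.HodgeConjecture.HodgeConjecture.Theses.NikulinTwinTransport
import Summits.HodgeConjecture.HodgeConjecture.Theorems.NikulinTwinTransportTwinSimilitudeAlgebraicMarkings
import Summits.HodgeConjecture.HodgeConjecture.Theorems.AnchorTransportAnchorExistenceK3SquareCMFloorSignatureReal
import Summits.HodgeConjecture.HodgeConjecture.Theorems.NikulinTwinTransportAlgebraicClassesOneOneK3Proof
import Literature.AlgebraicGeometry.Surfaces.K3Marking
import Literature.AlgebraicGeometry.Surfaces.K3HodgeTypesHolds
import Literature.AlgebraicGeometry.HodgeTheory.HodgeIndexSurface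

/-!
# Route NikulinTwinTransport · crux `TwinSimilitudeAlgebraic` (stmt-HodgeConjecture-13674) —
# the Hodge index theorem for a projective K3 surface from a marking and Lefschetz `(1,1)`

The sixth conjunct of the status stub `HodgeK3Facts` of line `hyperkaehler-nikulin-anchors`
(`∀ S, IsK3Surface S → hodgeIndex_surface S`, the tree's named fact `hodgeIndex_surface`,
Hartshorne V Thm. 1.9 in its sign-free homological form) is DERIVED here from the first conjunct
(markings, `Huybrechts_K3_marking_exists`, Huybrechts Ch. 1 Prop. 3.5 with Ch. 6 Prop. 1.2) and the
route item `LefschetzOneOneK3` (stmt-HodgeConjecture-13678), i.e. from inputs the K3-level stubs of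
the line (and the glue item `RealMultiplicationGlue`, stmt-HodgeConjecture-13681, whose linear
algebra on `NS(S)` it serves) already take as hypotheses:
`hodgeIndex_surface_of_isK3Surface`, `hodgeIndex_K3_of_marking`.

Proof (Huybrechts, *Lectures on K3 Surfaces*, Ch. 1 Prop. 2.4 and Rem. 3.6: "the Hodge index
theorem for K3 surfaces follows from the signature `(3, 19)` of `Λ_{K3}`"). Mark `S`:
`η : H²(S(ℂ); ℂ) ≅ Λ_ℂ`, `a ∪ b = (ηa.ηb) p`, `p ≠ 0`, period `x = ησ` with `(x.x) = 0`,
`(x̄.x) > 0`, and an integral `u ∈ Λ` with `(u.x) = 0`, `(u.u) > 0`.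
* THE AMPLE CLASS is `h := η⁻¹u`: integral hence rational; of type `(1,1)` because `(u.x) = 0` and,
  `u` being real, `(u.x̄) = \overline{(u.x)} = 0` (`Huybrechts_K3_hodgeTypes_H2_holds`:
  `H^{1,1} = ⟨σ, σ̄⟩^⊥`, with `σ̄ = η⁻¹x̄`, `conjClass_marking_symm`); hence ALGEBRAIC by Lefschetz
  `(1,1)` for K3 (the hypothesis `hL`); and `h ∪ h = (u.u) p ≠ 0`.
* THE INDEX: a rational algebraic `c` is of type `(1,1)` unconditionally
  (`isOfHodgeType_oneOne_of_mem_algebraicClasses_surface`, the proved route item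
  `AlgebraicClassesOneOneK3`), so `a := ηc ∈ Λ_ℚ` is a REAL vector orthogonal to `Re x`, `Im x`
  (`(c.σ) = 0`); if moreover `c ∪ h = 0` then `a ⊥ u`, and for `c ≠ 0` the signature-`(3,19)`
  computation of the tree (`AnchorExistenceCMFloor.k3FormR_self_neg_of_orthogonal`: the real K3
  form is negative definite on the orthogonal complement of the positive three-space
  `⟨Re x, Im x, u⟩` — `E₈` positive definite by Serre's sum of squares, Sylvester by a dimension
  count; the positivity of the three-space is `k3Period_re_im` / `k3Period_intCast_orthogonal` of
  `K3PeriodSurjectivityProofs`) gives `(a.a) < 0`, so `c ∪ c = (a.a) p ≠ 0`.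

Why `hL` cannot be dropped with the tree's present material: `hodgeIndex_surface S` asks for an
ALGEBRAIC `h`; without Lefschetz `(1,1)` the only algebraic class the tree produces is the
hyperplane class of `nonempty_hardLefschetzNFold_holds`, whose square is non-zero (hard Lefschetz)
but of UNDETERMINED SIGN relative to `(σ.σ̄) > 0` (the Hodge–Riemann sign `∫ ω² > 0` transported
through de Rham and the marking is not in the tree), and with a negative `h` the `∀ c` clause is not
a consequence of the signature alone.

## References

* [Huybrechts2016K3] D. Huybrechts, Lectures on K3 Surfaces, CUP 2016, Ch. 1 Prop. 2.4, Prop. 3.5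
  and Rem. 3.6; Ch. 3 Lemma 3.1; Ch. 6 Prop. 1.2 and Prop. 1.5.
* [Hartshorne1977] R. Hartshorne, Algebraic Geometry, GTM 52, V Thm. 1.9 and Rem. 1.9.1.
-/

noncomputable section

set_option linter.dupNamespace false

open CategoryTheory MonoidalCategory
open scoped Manifold Matrix
open Literature.AlgebraicGeometry.Motives Literature.AlgebraicGeometry.HodgeTheory
open Literature.AlgebraicGeometry.Surfaces Literature.Geometry.Kaehler
open Literature.AlgebraicTopology.SingularHomology
open Summit.HodgeConjecture.HodgeConjecture.Theses.NikulinTwinTransport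
open Summit.HodgeConjecture.HodgeConjecture.Theorems.AnchorExistenceCMFloor

namespace Summit.HodgeConjecture.HodgeConjecture.Theorems.NikulinTwinTransport

variable {S : SchemeOver ℂ}

/-! ### Real vectors of `Λ_ℂ` against the real K3 form -/

/-- Integral vectors of `Λ_ℂ` are real. [folklore] -/
theorem star_intCastΛ (u : K3Index → ℤ) :
    star (fun i => (u i : ℂ)) = fun i => (u i : ℂ) := by
  funext i
  simp only [Pi.star_apply, star_intCast]

/-- A real vector orthogonal to `x` is orthogonal to `x̄` (the K3 form is defined over `ℤ`).
[cite: Huybrechts2016K3, Ch. 6 §1.1] -/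
theorem k3Form_star_right_eq_zero_of_real {v x : K3Index → ℂ} (hv : star v = v)
    (hvx : k3Form v x = 0) : k3Form v (star x) = 0 := by
  have h := congrArg star hvx
  rwa [star_k3Form, hv, star_zero] at h

/-- Integral vectors of `Λ_ℂ` are real vectors (cast through `ℝ`). [folklore] -/
theorem intCastΛ_eq_realCast (u : K3Index → ℤ) :
    (fun i => (u i : ℂ)) = fun i => (((u i : ℝ) : ℝ) : ℂ) := by
  funext i
  push_cast
  rfl

/-- Rational vectors of `Λ_ℂ` are real vectors (cast through `ℝ`). [folklore] -/
theorem ratCastΛ_eq_realCast (w : K3Index → ℚ) :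
    (fun i => (w i : ℂ)) = fun i => (((w i : ℝ) : ℝ) : ℂ) := by
  funext i
  push_cast
  rfl

/-- **A real vector orthogonal to `x ∈ Λ_ℂ` is orthogonal to `Re x` and `Im x`** for the real K3
form (real and imaginary parts of `(a.x) = 0`; the rational analogue of
`k3Period_intCast_orthogonal`). [cite: Huybrechts2016K3, Ch. 6 §1.1 and Prop. 1.5 (proof)] -/
theorem k3FormR_re_im_eq_zero_of_k3Form_realCast {a : K3Index → ℝ} {x : K3Index → ℂ}
    (h : k3Form (fun i => (a i : ℂ)) x = 0) :
    k3FormR a (fun i => (x i).re) = 0 ∧ k3FormR a (fun i => (x i).im) = 0 := by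
  -- adapted from `k3Period_intCast_orthogonal` (`K3PeriodSurjectivityProofs`)
  have hx : x = (fun i => ((x i).re : ℂ)) + Complex.I • fun i => ((x i).im : ℂ) := by
    funext i
    apply Complex.ext <;> simp
  rw [hx, k3Form_add_right, k3Form_smul_right, k3Form_realCast, k3Form_realCast] at h
  have hre := congrArg Complex.re h
  have him := congrArg Complex.im h
  simp only [Complex.add_re, Complex.ofReal_re, Complex.mul_re, Complex.I_re, zero_mul,
    Complex.I_im, Complex.ofReal_im, mul_zero, sub_zero, add_zero, Complex.zero_re,
    Complex.add_im, Complex.mul_im, one_mul, zero_add, Complex.zero_im] at hre him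
  exact ⟨hre, him⟩

/-- **The positive three-space of a projective period point, in terms of the real K3 form**: for a
period `x` (`(x.x) = 0`, `(x̄.x) > 0`) and an ample lattice vector `u` (`(u.x) = 0`, `(u.u) > 0`),
the real vectors `Re x`, `Im x`, `u` are pairwise orthogonal of positive square
(`k3Period_re_im`, `k3Period_intCast_orthogonal`). [cite: Huybrechts2016K3, Ch. 6 Prop. 1.5 (proof) and Ch. 7 §3.2] -/
theorem k3FormR_posThree {x : K3Index → ℂ} {u : K3Index → ℤ} (hxx : k3Form x x = 0)
    (hxpos : 0 < (k3Form (star x) x).re) (hux : k3Form (fun i => (u i : ℂ)) x = 0)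
    (huu : 0 < ∑ i, ∑ j, u i * k3Gram i j * u j) :
    0 < k3FormR (fun i => (x i).re) (fun i => (x i).re) ∧
      0 < k3FormR (fun i => (x i).im) (fun i => (x i).im) ∧
      0 < k3FormR (fun i => (u i : ℝ)) (fun i => (u i : ℝ)) ∧
      k3FormR (fun i => (x i).re) (fun i => (x i).im) = 0 ∧
      k3FormR (fun i => (x i).re) (fun i => (u i : ℝ)) = 0 ∧
      k3FormR (fun i => (x i).im) (fun i => (u i : ℝ)) = 0 := by
  obtain ⟨hC, hAB, hA⟩ := k3Period_re_im hxx hxpos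
  obtain ⟨hur, hui⟩ := k3Period_intCast_orthogonal hux
  refine ⟨?_, ?_, ?_, ?_, ?_, ?_⟩
  · rw [k3FormR_apply]
    exact hA
  · rw [k3FormR_apply]
    show 0 < ∑ i, ∑ j, (x i).im * (k3Gram i j : ℝ) * (x j).im
    rw [← hAB]
    exact hA
  · rw [k3FormR_intCast]
    exact_mod_cast huu
  · rw [k3FormR_apply]
    exact hC
  · rw [k3FormR_comm, k3FormR_apply]
    exact hur
  · rw [k3FormR_comm, k3FormR_apply]
    exact hui

/-- **The real K3 form is negative on the non-zero real vectors orthogonal to `x` and `u`**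
(signature `(3,19)` of `Λ_{K3}`: `k3FormR_self_neg_of_orthogonal` applied to the positive
three-space `⟨Re x, Im x, u⟩` of `k3FormR_posThree`) — the Hodge–Riemann sign on the real
`(1,1)`-classes orthogonal to the ample class. [cite: Huybrechts2016K3, Ch. 1 Prop. 3.5, Rem. 3.6 and Ch. 3 Lemma 3.1] -/
theorem k3FormR_self_neg_of_k3Form_orthogonal {x : K3Index → ℂ} {u : K3Index → ℤ}
    {a : K3Index → ℝ} (hxx : k3Form x x = 0) (hxpos : 0 < (k3Form (star x) x).re)
    (hux : k3Form (fun i => (u i : ℂ)) x = 0) (huu : 0 < ∑ i, ∑ j, u i * k3Gram i j * u j)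
    (hax : k3Form (fun i => (a i : ℂ)) x = 0)
    (hau : k3Form (fun i => (a i : ℂ)) (fun i => (u i : ℂ)) = 0) (ha : a ≠ 0) :
    k3FormR a a < 0 := by
  obtain ⟨hp, hq, hr, hpq, hpr, hqr⟩ := k3FormR_posThree hxx hxpos hux huu
  obtain ⟨hap, haq⟩ := k3FormR_re_im_eq_zero_of_k3Form_realCast hax
  have har : k3FormR a (fun i => (u i : ℝ)) = 0 := by
    rw [intCastΛ_eq_realCast, k3Form_realCast] at hau
    exact_mod_cast hau
  exact k3FormR_self_neg_of_orthogonal hp hq hr hpq hpr hqr hap haq har ha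

/-! ### The Hodge index theorem for K3 surfaces -/

/-- **The Hodge index theorem for a projective K3 surface, from a marking and Lefschetz `(1,1)`.**
Granted markings of K3 surfaces (`Huybrechts_K3_marking_exists`, Huybrechts Ch. 1 Prop. 3.5 with
Ch. 6 Prop. 1.2 and an ample lattice vector) and Lefschetz `(1,1)` for K3 surfaces (route item
`LefschetzOneOneK3`), every projective K3 surface `S` satisfies the tree's named fact
`hodgeIndex_surface S` (Hartshorne V Thm. 1.9, sign-free): the class `h = η⁻¹u` of the ample lattice
vector is rational, of type `(1,1)`, algebraic, with `h ∪ h ≠ 0`, and every non-zero rational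
algebraic `c` with `c ∪ h = 0` has `c ∪ c ≠ 0` — by the signature `(3,19)` of `Λ_{K3}` (the real K3
form is negative definite on `⟨Re x, Im x, u⟩^⊥`).
[cite: Huybrechts2016K3, Ch. 1 Prop. 2.4, Prop. 3.5 and Rem. 3.6; Ch. 6 Prop. 1.2]
[cite: Hartshorne1977, V Thm. 1.9] -/
theorem hodgeIndex_surface_of_isK3Surface (hmark : Huybrechts_K3_marking_exists)
    (hL : LefschetzOneOneK3) (hS : IsK3Surface S) : hodgeIndex_surface S := by
  intro hSP
  obtain ⟨η, p, x, hp0, ⟨-, -, hint, hcup, h20, -⟩, hxx, hxpos, u, hux, huu⟩ := hmark S hS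
  -- ### the `(2,0)`-class `σ = η⁻¹ x`, its conjugate, and the Hodge types of `H²(S)`
  have hx0 : x ≠ 0 := ne_zero_of_star_self_re_pos hxpos
  have hσ0 : η.symm x ≠ 0 := fun e => hx0 (η.symm.map_eq_zero_iff.1 e)
  have hHT := Huybrechts_K3_hodgeTypes_H2_holds S hS (η.symm x) h20 hσ0
  have hconj : conjClass (ComplexPoints S) (2 * 1) (η.symm x) = η.symm (star x) :=
    conjClass_marking_symm η hint x
  -- ### the ample class `h = η⁻¹ u`
  have hux' : k3Form (fun i => (u i : ℂ)) (star x) = 0 :=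
    k3Form_star_right_eq_zero_of_real (star_intCastΛ u) hux
  have hηh : η (η.symm fun i => (u i : ℂ)) = fun i => (u i : ℂ) := η.apply_symm_apply _
  have hhrat : IsRationalClass (η.symm fun i => (u i : ℂ)) :=
    ((hint _).2 ⟨u, hηh⟩).isRationalClass
  have hh11 : IsOfHodgeType 2 S (2 * 1) 1 1 (η.symm fun i => (u i : ℂ)) := by
    refine (hHT.2.2 _).2 ⟨?_, ?_⟩
    · rw [hcup, hηh, η.apply_symm_apply, hux, zero_smul]
    · rw [hconj, hcup, hηh, η.apply_symm_apply, hux', zero_smul]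
  have hhN : (η.symm fun i => (u i : ℂ)) ∈ algebraicClasses S 1 := hL S hS _ hhrat hh11
  have hhh : cupProduct (rfl : 2 * 1 + 2 * 1 = 2 * 2) (η.symm fun i => (u i : ℂ))
      (η.symm fun i => (u i : ℂ)) ≠ 0 := by
    rw [hcup, hηh, k3Form_intCast]
    exact smul_ne_zero (Int.cast_ne_zero.2 huu.ne') hp0
  refine ⟨η.symm fun i => (u i : ℂ), hhrat, hh11, hhN, hhh, ?_⟩
  -- ### the index: a rational algebraic `c ⊥ h` is real and orthogonal to `x`, `u` in `Λ_ℂ`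
  intro c hc hcN hch hc0
  have hc11 : IsOfHodgeType 2 S (2 * 1) 1 1 c :=
    isOfHodgeType_oneOne_of_mem_algebraicClasses_surface hSP hcN
  have hcσ : cupProduct (rfl : 2 * 1 + 2 * 1 = 2 * 2) c (η.symm x) = 0 := ((hHT.2.2 c).1 hc11).1
  obtain ⟨w, hw⟩ := (isRationalClass_iff_of_marking hS η hint c).1 hc
  rw [ratCastΛ_eq_realCast] at hw
  have hax : k3Form (fun i => (((w i : ℝ) : ℝ) : ℂ)) x = 0 := by
    rw [hcup, hw, η.apply_symm_apply, smul_eq_zero] at hcσ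
    exact hcσ.resolve_right hp0
  have hau : k3Form (fun i => (((w i : ℝ) : ℝ) : ℂ)) (fun i => (u i : ℂ)) = 0 := by
    have e : cupProduct (rfl : 2 * 1 + 2 * 1 = 2 * 2) c (η.symm fun i => (u i : ℂ)) = 0 := hch
    rw [hcup, hw, hηh, smul_eq_zero] at e
    exact e.resolve_right hp0
  have ha : (fun i => ((w i : ℝ) : ℝ)) ≠ 0 := by
    intro h0
    apply hc0
    apply η.injective
    rw [hw, map_zero]
    funext i
    have hi : ((w i : ℝ) : ℝ) = 0 := congrFun h0 i
    rw [Pi.zero_apply, hi, Complex.ofReal_zero]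
  -- ### signature `(3,19)`: `(a.a) < 0`, so `c ∪ c = (a.a) p ≠ 0`
  have hneg := k3FormR_self_neg_of_k3Form_orthogonal hxx hxpos hux huu hax hau ha
  intro hcc
  have e : cupProduct (rfl : 2 * 1 + 2 * 1 = 2 * 2) c c = 0 := hcc
  rw [hcup, hw, k3Form_realCast, smul_eq_zero] at e
  rcases e with e | e
  · exact hneg.ne (by exact_mod_cast e)
  · exact hp0 e

/-- **The sixth conjunct of `HodgeK3Facts` from the first and `LefschetzOneOneK3`**: granted
markings and Lefschetz `(1,1)` for K3 surfaces, `hodgeIndex_surface S` holds for every projective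
K3 surface `S` (the shape consumed by the line's stubs `WittCompletion` / `exists_nsProjection`).
[cite: Huybrechts2016K3, Ch. 1 Prop. 2.4 and Rem. 3.6] [cite: Hartshorne1977, V Thm. 1.9] -/
theorem hodgeIndex_K3_of_marking (hmark : Huybrechts_K3_marking_exists) (hL : LefschetzOneOneK3) :
    ∀ S : SchemeOver ℂ, IsK3Surface S → hodgeIndex_surface S :=
  fun _ hS ↦ hodgeIndex_surface_of_isK3Surface hmark hL hS

end Summit.HodgeConjecture.HodgeConjecture.Theorems.NikulinTwinTransport

end
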